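import Literature.Analysis.InverseSpectral.KreinStringWeylSolution
import HarnessLib

/-!
# Kreĭn strings: the Weyl solutions on the negative axis and their Gram identity

For a Kreĭn string `S` other than the free half-line and `s > 0`, the Weyl solution
`ω(·, -s) = q_S(-s) φ(·,-s) - ψ(·,-s)` is a positive, non-increasing function on `[0, L)`; we prove
the **Gram identity**

  `∫_{[0,L)} ω(t,-s) ω(t,-s') dm(t) = ∫ dσ(λ) / ((λ+s)(λ+s'))   (s, s' > 0)`

where `(b, σ)` are the Stieltjes data of `q_S` (Kac–Kreĭn 1974 §2, the resolvent identity for the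
kernel of the string at the point `0`; Dym–McKean 1976 §5.4). For `s ≠ s'` it comes from the
Lagrange identity for `ω(·,-s)`, `ω(·,-s')` and the vanishing at `L` of the boundary term, which is
controlled by the elementary inequalities `φ⁺' I ≤ φ⁻¹` and the monotonicity of `φ(·,-s)/φ(·,-s')`
(`s ≥ s'`); the diagonal `s = s'` follows from Fatou's lemma (`ω(·,-s) ∈ L²(dm)`,
`‖ω(·,-s)‖² ≤ ∫ dσ/(λ+s)²`) and the Cauchy–Schwarz inequality.

Everything here is PROVED; no named facts.

## References

KacKrein1974 (§2), DymMcKean1976 (§5.4), Tomisaki1988 (§4).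
-/

open MeasureTheory Filter Set Topology ComplexConjugate
open scoped ENNReal

noncomputable section

namespace Literature.Analysis.InverseSpectral

namespace KreinString

variable (S : KreinString)

/-! ### Real notation on the negative axis -/

/-- `-s ∈ ℂ ∖ [0, ∞)` for `s > 0`. [folklore] -/
lemma neg_mem_offNonnegAxis {s : ℝ} (hs : 0 < s) : (-(s : ℂ)) ∈ offNonnegAxis := Or.inr (by simpa using hs)

/-- `φ(t, -s)` is real: `φ = Re φ`. [folklore] -/
lemma phi_neg_eq_re (s t : ℝ) : S.phi (-(s : ℂ)) t = ((S.phi (-(s : ℂ)) t).re : ℂ) :=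
  Complex.ext (by simp) (by simp [S.phi_neg_im s t])

/-- The right derivative `φ⁺'(t, -s) = s ∫_{[0,t]} φ(·,-s) dm` as a real number. [folklore] -/
def dphiNeg (s t : ℝ) : ℝ := s * ∫ u in Icc 0 t, (S.phi (-(s : ℂ)) u).re ∂S.massMeasure

/-- `-z ∫_{[0,t]} φ dm = φ⁺'(t,-s)` is the real number `dphiNeg`. [folklore] -/
lemma neg_mul_integral_phi_eq (s t : ℝ) :
    -(-(s : ℂ)) * ∫ u in Icc 0 t, S.phi (-(s : ℂ)) u ∂S.massMeasure = (S.dphiNeg s t : ℂ) := by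
  rw [dphiNeg, neg_neg, Complex.ofReal_mul, ← integral_complex_ofReal]
  congr 1
  exact integral_congr_ae (ae_of_all _ fun u => S.phi_neg_eq_re s u)

/-- `φ⁺'(t,-s) ≥ 0`. [folklore] -/
lemma dphiNeg_nonneg {s : ℝ} (hs : 0 ≤ s) {t : ℝ} (ht : t ∈ S.dom) : 0 ≤ S.dphiNeg s t := by
  unfold dphiNeg
  refine mul_nonneg hs (setIntegral_nonneg measurableSet_Icc fun u hu => ?_)
  linarith [S.one_le_phi_neg_re hs (S.Icc_subset_dom ht hu)]

/-- `t ↦ φ⁺'(t,-s)` is non-decreasing on `[0, L)`. [folklore] -/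
lemma dphiNeg_mono {s : ℝ} (hs : 0 ≤ s) {t t' : ℝ} (ht' : t' ∈ S.dom) (htt' : t ≤ t') :
    S.dphiNeg s t ≤ S.dphiNeg s t' := by
  unfold dphiNeg
  refine mul_le_mul_of_nonneg_left ?_ hs
  have hint : IntegrableOn (fun u => (S.phi (-(s : ℂ)) u).re) (Icc 0 t') S.massMeasure :=
    S.integrableOn_Icc_of_continuousOn ht' (Complex.continuous_re.comp_continuousOn
      ((S.isSolution_phi _).1.mono (S.Icc_subset_dom ht')))
  refine setIntegral_mono_set hint ?_ (Icc_subset_Icc_right htt').eventuallyLE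
  exact (ae_restrict_iff' measurableSet_Icc).2 (ae_of_all _ fun u hu =>
    zero_le_one.trans (S.one_le_phi_neg_re hs (S.Icc_subset_dom ht' hu)))


/-- `φ(t,-s) > 0` on `[0, L)`. [folklore] -/
lemma phi_neg_re_pos {s : ℝ} (hs : 0 ≤ s) {t : ℝ} (ht : t ∈ S.dom) : 0 < (S.phi (-(s : ℂ)) t).re :=
  lt_of_lt_of_le zero_lt_one (S.one_le_phi_neg_re hs ht)

/-- The right derivative of `t ↦ Re φ(t,-s)` within `[t, ∞)` is `dphiNeg s t`. [folklore] -/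
lemma hasDerivWithinAt_phi_neg_re (s : ℝ) {t : ℝ} (ht : t ∈ S.dom) :
    HasDerivWithinAt (fun u => (S.phi (-(s : ℂ)) u).re) (S.dphiNeg s t) (Ici t) t := by
  have h := S.hasDerivWithinAt_phi (-(s : ℂ)) ht
  have h2 := (Complex.reCLM.hasFDerivAt.comp_hasDerivWithinAt t h)
  have hval : Complex.reCLM (-(-(s : ℂ)) * ∫ u in Icc 0 t, S.phi (-(s : ℂ)) u ∂S.massMeasure) =
      S.dphiNeg s t := by
    rw [S.neg_mul_integral_phi_eq, Complex.reCLM_apply, Complex.ofReal_re]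
  rw [hval] at h2
  exact h2

/-- `q_S(-s)` is real and positive (`s > 0`). [folklore] -/
lemma principalWeylFunction_neg_eq_re (hS : ¬ S.IsTrivial) {s : ℝ} (hs : 0 < s) :
    S.principalWeylFunction (-(s : ℂ)) = ((S.principalWeylFunction (-(s : ℂ))).re : ℂ) := by
  have h := (S.tendsto_principalWeylFunction_of_neg hS (z := -(s : ℂ)) (by simp) (by simpa using hs)).2.2
  exact Complex.ext (by simp) (by simp [h])

/-- Auxiliary fact about Kreĭn strings (see the section header). [folklore] -/
lemma principalWeylFunction_neg_re_pos (hS : ¬ S.IsTrivial) {s : ℝ} (hs : 0 < s) :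
    0 < (S.principalWeylFunction (-(s : ℂ))).re :=
  (S.tendsto_principalWeylFunction_of_neg hS (z := -(s : ℂ)) (by simp) (by simpa using hs)).2.1

/-- The complex integral `∫ₜ^{x} φ(u,-s)⁻² du` is the real integral of `(Re φ)⁻²`. [folklore] -/
lemma integral_inv_phi_sq_neg_eq (s t x : ℝ) :
    ∫ u in t..x, ((S.phi (-(s : ℂ)) u) ^ 2)⁻¹ =
      ((∫ u in t..x, ((S.phi (-(s : ℂ)) u).re ^ 2)⁻¹ : ℝ) : ℂ) := by
  rw [← intervalIntegral.integral_ofReal]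
  refine intervalIntegral.integral_congr (fun u _ => ?_)
  rw [S.phi_neg_eq_re s u]
  push_cast
  simp

/-- The tail integral at `-s` as a real number: `I(t,-s) = Re q_S(-s) - ∫₀ᵗ (Re φ)⁻²`. [folklore] -/
lemma tailInt_neg_ofReal (hS : ¬ S.IsTrivial) {s : ℝ} (hs : 0 < s) (t : ℝ) :
    S.tailInt (-(s : ℂ)) t = (((S.principalWeylFunction (-(s : ℂ))).re -
      ∫ u in (0 : ℝ)..t, ((S.phi (-(s : ℂ)) u).re ^ 2)⁻¹ : ℝ) : ℂ) := by
  unfold tailInt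
  rw [S.integral_inv_phi_sq_neg_eq]
  conv_lhs => rw [S.principalWeylFunction_neg_eq_re hS hs]
  push_cast
  rfl

/-- Auxiliary fact about Kreĭn strings (see the section header). [folklore] -/
lemma tailInt_neg_re (hS : ¬ S.IsTrivial) {s : ℝ} (hs : 0 < s) (t : ℝ) :
    (S.tailInt (-(s : ℂ)) t).re = (S.principalWeylFunction (-(s : ℂ))).re -
      ∫ u in (0 : ℝ)..t, ((S.phi (-(s : ℂ)) u).re ^ 2)⁻¹ := by
  rw [S.tailInt_neg_ofReal hS hs, Complex.ofReal_re]

/-- The tail integral at `-s` is real. [folklore] -/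
lemma tailInt_neg_eq_re (hS : ¬ S.IsTrivial) {s : ℝ} (hs : 0 < s) (t : ℝ) :
    S.tailInt (-(s : ℂ)) t = ((S.tailInt (-(s : ℂ)) t).re : ℂ) := by
  rw [S.tailInt_neg_re hS hs, ← S.tailInt_neg_ofReal hS hs]

/-- `∫ₜ^{x'} (Re φ(·,-s))⁻² → Re I(t,-s)` as `x' → L`. [folklore] -/
lemma tendsto_integral_inv_phi_neg_re_sq (hS : ¬ S.IsTrivial) {s : ℝ} (hs : 0 < s) {t : ℝ}
    (ht : t ∈ S.dom) :
    Tendsto (fun x' => ∫ u in t..x', ((S.phi (-(s : ℂ)) u).re ^ 2)⁻¹) S.toEnd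
      (𝓝 (S.tailInt (-(s : ℂ)) t).re) := by
  have h := (Complex.continuous_re.tendsto _).comp
    (S.tendsto_integral_inv_phi_sq hS (neg_mem_offNonnegAxis hs) ht)
  refine h.congr fun x' => ?_
  simp only [Function.comp_apply, S.integral_inv_phi_sq_neg_eq, Complex.ofReal_re]

/-- `Re I(t,-s) ≥ 0`. [folklore] -/
lemma tailInt_neg_re_nonneg (hS : ¬ S.IsTrivial) {s : ℝ} (hs : 0 < s) {t : ℝ} (ht : t ∈ S.dom) :
    0 ≤ (S.tailInt (-(s : ℂ)) t).re := by
  haveI := S.toEnd_neBot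
  refine ge_of_tendsto (S.tendsto_integral_inv_phi_neg_re_sq hS hs ht) ?_
  refine Filter.eventually_of_mem (S.Ici_inter_dom_mem_toEnd ht) fun x' hx' => ?_
  exact intervalIntegral.integral_nonneg hx'.2 fun u _ => by positivity

/-- Interval-integrability of `u ↦ φ⁺'(u,-s) g(u)` for `g` continuous, on `[t, x'] ⊆ [0, L)`. [folklore] -/
lemma intervalIntegrable_dphiNeg_mul {s : ℝ} (hs : 0 ≤ s) {t x' : ℝ} (ht : 0 ≤ t) (htx' : t ≤ x')
    (hx' : x' ∈ S.dom) {g : ℝ → ℝ} (hg : ContinuousOn g (Icc t x')) :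
    IntervalIntegrable (fun u => S.dphiNeg s u * g u) volume t x' := by
  have hmono : MonotoneOn (S.dphiNeg s) (uIcc t x') := by
    rw [uIcc_of_le htx']
    intro u hu v hv huv
    exact S.dphiNeg_mono hs (S.Icc_subset_dom hx' ⟨ht.trans hv.1, hv.2⟩) huv
  refine hmono.intervalIntegrable.mul_continuousOn ?_
  rwa [uIcc_of_le htx']

/-- **`φ⁺'(t,-s) ∫ₜ^{x'} φ⁻² ≤ φ(t,-s)⁻¹ - φ(x',-s)⁻¹`** for `t ≤ x'` in `[0, L)` (`φ⁺'` is
non-decreasing and `(φ⁻¹)⁺' = -φ⁺'/φ²`). [folklore] -/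
lemma dphiNeg_mul_integral_le {s : ℝ} (hs : 0 ≤ s) {t x' : ℝ} (ht : t ∈ S.dom) (htx' : t ≤ x')
    (hx' : x' ∈ S.dom) :
    S.dphiNeg s t * ∫ u in t..x', ((S.phi (-(s : ℂ)) u).re ^ 2)⁻¹ ≤
      ((S.phi (-(s : ℂ)) t).re)⁻¹ - ((S.phi (-(s : ℂ)) x').re)⁻¹ := by
  have hdom : Icc t x' ⊆ S.dom := fun u hu => S.Icc_subset_dom hx' ⟨ht.1.trans hu.1, hu.2⟩
  have hφc : ContinuousOn (fun u => (S.phi (-(s : ℂ)) u).re) (Icc t x') :=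
    Complex.continuous_re.comp_continuousOn ((S.isSolution_phi _).1.mono hdom)
  have hφpos : ∀ u ∈ Icc t x', 0 < (S.phi (-(s : ℂ)) u).re := fun u hu => S.phi_neg_re_pos hs (hdom hu)
  have hinvc : ContinuousOn (fun u => ((S.phi (-(s : ℂ)) u).re ^ 2)⁻¹) (Icc t x') :=
    (hφc.pow 2).inv₀ fun u hu => (pow_pos (hφpos u hu) 2).ne'
  -- FTC from the right for `g = (Re φ)⁻¹`
  have hFTC : ∫ u in t..x', -(S.dphiNeg s u) * ((S.phi (-(s : ℂ)) u).re ^ 2)⁻¹ =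
      ((S.phi (-(s : ℂ)) x').re)⁻¹ - ((S.phi (-(s : ℂ)) t).re)⁻¹ := by
    refine intervalIntegral.integral_eq_sub_of_hasDeriv_right_of_le htx'
      (hφc.inv₀ fun u hu => (hφpos u hu).ne') (fun u hu => ?_) ?_
    · have hud : u ∈ S.dom := hdom ⟨hu.1.le, hu.2.le⟩
      have h := ((S.hasDerivWithinAt_phi_neg_re s hud).inv (S.phi_neg_re_pos hs hud).ne').mono
        (Ioi_subset_Ici_self (a := u))
      refine h.congr_deriv ?_
      field_simp
    · have := (S.intervalIntegrable_dphiNeg_mul hs ht.1 htx' hx' hinvc).neg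
      refine this.congr ?_
      exact fun u _ => by simp only [Pi.neg_apply, neg_mul]
  have hFTC' : ∫ u in t..x', S.dphiNeg s u * ((S.phi (-(s : ℂ)) u).re ^ 2)⁻¹ =
      ((S.phi (-(s : ℂ)) t).re)⁻¹ - ((S.phi (-(s : ℂ)) x').re)⁻¹ := by
    have : ∫ u in t..x', S.dphiNeg s u * ((S.phi (-(s : ℂ)) u).re ^ 2)⁻¹ =
        -∫ u in t..x', -(S.dphiNeg s u) * ((S.phi (-(s : ℂ)) u).re ^ 2)⁻¹ := by
      rw [← intervalIntegral.integral_neg]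
      refine intervalIntegral.integral_congr fun u _ => ?_
      ring
    rw [this, hFTC]; ring
  -- monotonicity of `φ⁺'`
  calc S.dphiNeg s t * ∫ u in t..x', ((S.phi (-(s : ℂ)) u).re ^ 2)⁻¹
      = ∫ u in t..x', S.dphiNeg s t * ((S.phi (-(s : ℂ)) u).re ^ 2)⁻¹ := by
        rw [intervalIntegral.integral_const_mul]
    _ ≤ ∫ u in t..x', S.dphiNeg s u * ((S.phi (-(s : ℂ)) u).re ^ 2)⁻¹ := by
        refine intervalIntegral.integral_mono_on htx' ?_
          (S.intervalIntegrable_dphiNeg_mul hs ht.1 htx' hx' hinvc) fun u hu => ?_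
        · exact (hinvc.intervalIntegrable_of_Icc htx').const_mul _
        · exact mul_le_mul_of_nonneg_right (S.dphiNeg_mono hs (hdom hu) hu.1)
            (inv_nonneg.2 (sq_nonneg _))
    _ = ((S.phi (-(s : ℂ)) t).re)⁻¹ - ((S.phi (-(s : ℂ)) x').re)⁻¹ := hFTC'

/-- **`φ⁺'(t,-s) · I(t,-s) ≤ φ(t,-s)⁻¹`** on `[0, L)`. [cite: KacKrein1974, §2] -/
theorem dphiNeg_mul_tailInt_re_le (hS : ¬ S.IsTrivial) {s : ℝ} (hs : 0 < s) {t : ℝ} (ht : t ∈ S.dom) :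
    S.dphiNeg s t * (S.tailInt (-(s : ℂ)) t).re ≤ ((S.phi (-(s : ℂ)) t).re)⁻¹ := by
  haveI := S.toEnd_neBot
  have h := (S.tendsto_integral_inv_phi_neg_re_sq hS hs ht).const_mul (S.dphiNeg s t)
  refine le_of_tendsto h ?_
  refine Filter.eventually_of_mem (S.Ici_inter_dom_mem_toEnd ht) fun x' hx' => ?_
  have h1 := S.dphiNeg_mul_integral_le hs.le ht hx'.2 hx'.1
  have h2 : 0 ≤ ((S.phi (-(s : ℂ)) x').re)⁻¹ := inv_nonneg.2 (S.phi_neg_re_pos hs.le hx'.1).le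
  linarith

/-- The Weyl solution at `-s` is real and non-negative: `ω(t,-s) = φ(t,-s) I(t,-s) ≥ 0`. [folklore] -/
lemma weylSolution_neg_eq_re (hS : ¬ S.IsTrivial) {s : ℝ} (hs : 0 < s) {t : ℝ} (ht : t ∈ S.dom) :
    S.weylSolution (-(s : ℂ)) t = (((S.phi (-(s : ℂ)) t).re * (S.tailInt (-(s : ℂ)) t).re : ℝ) : ℂ) := by
  rw [S.weylSolution_eq (neg_mem_offNonnegAxis hs) ht]
  conv_lhs => rw [S.phi_neg_eq_re s t, S.tailInt_neg_eq_re hS hs t]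
  push_cast
  ring

/-- Auxiliary fact about Kreĭn strings (see the section header). [folklore] -/
lemma weylSolution_neg_re (hS : ¬ S.IsTrivial) {s : ℝ} (hs : 0 < s) {t : ℝ} (ht : t ∈ S.dom) :
    (S.weylSolution (-(s : ℂ)) t).re = (S.phi (-(s : ℂ)) t).re * (S.tailInt (-(s : ℂ)) t).re := by
  rw [S.weylSolution_neg_eq_re hS hs ht, Complex.ofReal_re]

/-- Auxiliary fact about Kreĭn strings (see the section header). [folklore] -/
lemma weylSolution_neg_re_nonneg (hS : ¬ S.IsTrivial) {s : ℝ} (hs : 0 < s) {t : ℝ} (ht : t ∈ S.dom) :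
    0 ≤ (S.weylSolution (-(s : ℂ)) t).re := by
  rw [S.weylSolution_neg_re hS hs ht]
  exact mul_nonneg (S.phi_neg_re_pos hs.le ht).le (S.tailInt_neg_re_nonneg hS hs ht)

/-- Auxiliary fact about Kreĭn strings (see the section header). [folklore] -/
lemma norm_weylSolution_neg (hS : ¬ S.IsTrivial) {s : ℝ} (hs : 0 < s) {t : ℝ} (ht : t ∈ S.dom) :
    ‖S.weylSolution (-(s : ℂ)) t‖ = (S.weylSolution (-(s : ℂ)) t).re := by
  conv_lhs => rw [show S.weylSolution (-(s : ℂ)) t = ((S.weylSolution (-(s : ℂ)) t).re : ℂ) from by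
    rw [S.weylSolution_neg_eq_re hS hs ht, Complex.ofReal_re]]
  rw [Complex.norm_real, Real.norm_of_nonneg (S.weylSolution_neg_re_nonneg hS hs ht)]

/-- The right derivative of the Weyl solution at `-s` is real with
`Re ω⁺'(t,-s) = φ⁺' I - φ⁻¹ ∈ [-φ⁻¹, 0]`, so `|ω⁺'(t,-s)| ≤ φ(t,-s)⁻¹`. [cite: KacKrein1974, §2] -/
lemma weylDeriv_neg_eq_re (hS : ¬ S.IsTrivial) {s : ℝ} (hs : 0 < s) {t : ℝ} (ht : t ∈ S.dom) :
    S.weylDeriv (-(s : ℂ)) t =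
      ((S.dphiNeg s t * (S.tailInt (-(s : ℂ)) t).re - ((S.phi (-(s : ℂ)) t).re)⁻¹ : ℝ) : ℂ) := by
  rw [S.weylDeriv_eq (neg_mem_offNonnegAxis hs) ht, S.neg_mul_integral_phi_eq]
  conv_lhs => rw [S.phi_neg_eq_re s t, S.tailInt_neg_eq_re hS hs t]
  push_cast
  ring

/-- Auxiliary fact about Kreĭn strings (see the section header). [folklore] -/
lemma norm_weylDeriv_neg_le (hS : ¬ S.IsTrivial) {s : ℝ} (hs : 0 < s) {t : ℝ} (ht : t ∈ S.dom) :
    ‖S.weylDeriv (-(s : ℂ)) t‖ ≤ ((S.phi (-(s : ℂ)) t).re)⁻¹ := by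
  rw [S.weylDeriv_neg_eq_re hS hs ht, Complex.norm_real, Real.norm_eq_abs, abs_le]
  have h1 := S.dphiNeg_mul_tailInt_re_le hS hs ht
  have h2 : 0 ≤ S.dphiNeg s t * (S.tailInt (-(s : ℂ)) t).re :=
    mul_nonneg (S.dphiNeg_nonneg hs.le ht) (S.tailInt_neg_re_nonneg hS hs ht)
  constructor <;> linarith


/-! ### Monotonicity of `φ(·,-s)/φ(·,-s')` for `s ≥ s'` -/

/-- `∫_{[0,u]} φ(·,-s) φ(·,-s') dm` as a real number. [folklore] -/
def phiProdInt (s s' u : ℝ) : ℝ :=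
  ∫ v in Icc 0 u, (S.phi (-(s : ℂ)) v).re * (S.phi (-(s' : ℂ)) v).re ∂S.massMeasure

/-- Auxiliary fact about Kreĭn strings (see the section header). [folklore] -/
lemma integral_phi_mul_phi_eq (s s' u : ℝ) :
    ∫ v in Icc 0 u, S.phi (-(s : ℂ)) v * S.phi (-(s' : ℂ)) v ∂S.massMeasure = (S.phiProdInt s s' u : ℂ) := by
  rw [phiProdInt, ← integral_complex_ofReal]
  refine integral_congr_ae (ae_of_all _ fun v => ?_)
  simp only
  rw [S.phi_neg_eq_re s v, S.phi_neg_eq_re s' v]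
  push_cast
  simp

/-- Auxiliary fact about Kreĭn strings (see the section header). [folklore] -/
lemma phiProdInt_nonneg {s s' : ℝ} (hs : 0 ≤ s) (hs' : 0 ≤ s') {u : ℝ} (hu : u ∈ S.dom) :
    0 ≤ S.phiProdInt s s' u := by
  unfold phiProdInt
  refine setIntegral_nonneg measurableSet_Icc fun v hv => mul_nonneg ?_ ?_
  · exact (S.phi_neg_re_pos hs (S.Icc_subset_dom hu hv)).le
  · exact (S.phi_neg_re_pos hs' (S.Icc_subset_dom hu hv)).le

/-- Auxiliary fact about Kreĭn strings (see the section header). [folklore] -/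
lemma phiProdInt_mono {s s' : ℝ} (hs : 0 ≤ s) (hs' : 0 ≤ s') {u u' : ℝ} (hu' : u' ∈ S.dom)
    (huu' : u ≤ u') : S.phiProdInt s s' u ≤ S.phiProdInt s s' u' := by
  unfold phiProdInt
  have hint : IntegrableOn (fun v => (S.phi (-(s : ℂ)) v).re * (S.phi (-(s' : ℂ)) v).re) (Icc 0 u')
      S.massMeasure :=
    S.integrableOn_Icc_of_continuousOn hu'
      ((Complex.continuous_re.comp_continuousOn ((S.isSolution_phi _).1.mono (S.Icc_subset_dom hu'))).mul
        (Complex.continuous_re.comp_continuousOn ((S.isSolution_phi _).1.mono (S.Icc_subset_dom hu'))))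
  refine setIntegral_mono_set hint ?_ (Icc_subset_Icc_right huu').eventuallyLE
  exact (ae_restrict_iff' measurableSet_Icc).2 (ae_of_all _ fun v hv => mul_nonneg
    (S.phi_neg_re_pos hs (S.Icc_subset_dom hu' hv)).le (S.phi_neg_re_pos hs' (S.Icc_subset_dom hu' hv)).le)

/-- **Lagrange identity for `φ(·,-s)`, `φ(·,-s')`** in real form:
`φ⁺'(u,-s) φ(u,-s') - φ(u,-s) φ⁺'(u,-s') = (s - s') ∫_{[0,u]} φ(·,-s) φ(·,-s') dm`.
[cite: KacKrein1974, §1] -/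
theorem dphiNeg_mul_sub (s s' : ℝ) {u : ℝ} (hu : u ∈ S.dom) :
    S.dphiNeg s u * (S.phi (-(s' : ℂ)) u).re - (S.phi (-(s : ℂ)) u).re * S.dphiNeg s' u =
      (s - s') * S.phiProdInt s s' u := by
  have hL := (S.isSolution_phi (-(s : ℂ))).lagrange (S.isSolution_phi (-(s' : ℂ))) hu
  rw [S.integral_phi_mul_phi_eq] at hL
  have e1 : (0 : ℂ) - -(s' : ℂ) * ∫ v in Icc 0 u, S.phi (-(s' : ℂ)) v ∂S.massMeasure = (S.dphiNeg s' u : ℂ) := by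
    rw [← S.neg_mul_integral_phi_eq]; ring
  have e2 : (0 : ℂ) - -(s : ℂ) * ∫ v in Icc 0 u, S.phi (-(s : ℂ)) v ∂S.massMeasure = (S.dphiNeg s u : ℂ) := by
    rw [← S.neg_mul_integral_phi_eq]; ring
  rw [e1, e2, S.phi_neg_eq_re s u, S.phi_neg_eq_re s' u] at hL
  have hre := congrArg Complex.re hL
  simp only [Complex.sub_re, Complex.mul_re, Complex.ofReal_re, Complex.ofReal_im, mul_zero,
    sub_zero, Complex.add_re, Complex.zero_re, mul_one, Complex.neg_re] at hre
  linarith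

/-- **`u ↦ φ(u,-s)/φ(u,-s')` is non-decreasing on `[0, L)` for `s ≥ s' ≥ 0`.** [folklore] -/
theorem phi_div_phi_mono {s s' : ℝ} (hs' : 0 ≤ s') (hss' : s' ≤ s) {t x : ℝ} (ht : t ∈ S.dom)
    (htx : t ≤ x) (hx : x ∈ S.dom) :
    (S.phi (-(s : ℂ)) t).re / (S.phi (-(s' : ℂ)) t).re ≤ (S.phi (-(s : ℂ)) x).re / (S.phi (-(s' : ℂ)) x).re := by
  have hs : 0 ≤ s := hs'.trans hss'
  have hdom : Icc t x ⊆ S.dom := fun u hu => S.Icc_subset_dom hx ⟨ht.1.trans hu.1, hu.2⟩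
  have hφc : ∀ r : ℝ, ContinuousOn (fun u => (S.phi (-(r : ℂ)) u).re) (Icc t x) := fun r =>
    Complex.continuous_re.comp_continuousOn ((S.isSolution_phi _).1.mono hdom)
  set R : ℝ → ℝ := fun u => (S.phi (-(s : ℂ)) u).re / (S.phi (-(s' : ℂ)) u).re with hR
  set R' : ℝ → ℝ := fun u => (s - s') * S.phiProdInt s s' u * ((S.phi (-(s' : ℂ)) u).re ^ 2)⁻¹ with hR'
  have hcont : ContinuousOn R (Icc t x) := (hφc s).div (hφc s') fun u hu => (S.phi_neg_re_pos hs' (hdom hu)).ne'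
  have hderiv : ∀ u ∈ Ioo t x, HasDerivWithinAt R (R' u) (Ioi u) u := by
    intro u hu
    have hud : u ∈ S.dom := hdom ⟨hu.1.le, hu.2.le⟩
    have h := ((S.hasDerivWithinAt_phi_neg_re s hud).div (S.hasDerivWithinAt_phi_neg_re s' hud)
      (S.phi_neg_re_pos hs' hud).ne').mono (Ioi_subset_Ici_self (a := u))
    refine h.congr_deriv ?_
    rw [hR', S.dphiNeg_mul_sub s s' hud]
    simp only
    rw [div_eq_mul_inv]
  have hinvc : ContinuousOn (fun u => ((S.phi (-(s' : ℂ)) u).re ^ 2)⁻¹) (Icc t x) :=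
    ((hφc s').pow 2).inv₀ fun u hu => (pow_pos (S.phi_neg_re_pos hs' (hdom hu)) 2).ne'
  have hint : IntervalIntegrable R' volume t x := by
    have hmono : MonotoneOn (fun u => (s - s') * S.phiProdInt s s' u) (uIcc t x) := by
      rw [uIcc_of_le htx]
      intro u hu v hv huv
      exact mul_le_mul_of_nonneg_left (S.phiProdInt_mono hs hs' (hdom hv) huv) (by linarith)
    have h1 : IntervalIntegrable (fun u => (s - s') * S.phiProdInt s s' u) volume t x :=
      hmono.intervalIntegrable
    have h2 : ContinuousOn (fun u => ((S.phi (-(s' : ℂ)) u).re ^ 2)⁻¹) (uIcc t x) := by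
      rwa [uIcc_of_le htx]
    exact h1.mul_continuousOn h2
  have hFTC := intervalIntegral.integral_eq_sub_of_hasDeriv_right_of_le htx hcont hderiv hint
  have hnn : 0 ≤ ∫ u in t..x, R' u :=
    intervalIntegral.integral_nonneg htx fun u hu => mul_nonneg
      (mul_nonneg (by linarith) (S.phiProdInt_nonneg hs hs' (hdom hu))) (inv_nonneg.2 (sq_nonneg _))
  rw [hFTC] at hnn
  simpa [hR] using hnn

/-! ### The boundary term on the negative axis -/

/-- For `0 < s' < s`: `ω(x,-s)/φ(x,-s') ≤ I(x,-s')`. [folklore] -/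
theorem weylSolution_re_div_le (hS : ¬ S.IsTrivial) {s s' : ℝ} (hs' : 0 < s') (hss' : s' < s) {x : ℝ}
    (hx : x ∈ S.dom) :
    (S.weylSolution (-(s : ℂ)) x).re / (S.phi (-(s' : ℂ)) x).re ≤ (S.tailInt (-(s' : ℂ)) x).re := by
  haveI := S.toEnd_neBot
  have hs : 0 < s := hs'.trans hss'
  rw [S.weylSolution_neg_re hS hs hx, mul_comm, mul_div_assoc]
  -- both sides as limits of integrals over `[x, x']`
  have hL := (S.tendsto_integral_inv_phi_neg_re_sq hS hs hx).mul_const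
    ((S.phi (-(s : ℂ)) x).re / (S.phi (-(s' : ℂ)) x).re)
  have hR := S.tendsto_integral_inv_phi_neg_re_sq hS hs' hx
  refine le_of_tendsto_of_tendsto hL hR ?_
  refine Filter.eventually_of_mem (S.Ici_inter_dom_mem_toEnd hx) fun x' hx' => ?_
  have hdom : Icc x x' ⊆ S.dom := fun u hu => S.Icc_subset_dom hx'.1 ⟨hx.1.trans hu.1, hu.2⟩
  have hφc : ∀ r : ℝ, ContinuousOn (fun u => (S.phi (-(r : ℂ)) u).re) (Icc x x') := fun r =>
    Complex.continuous_re.comp_continuousOn ((S.isSolution_phi _).1.mono hdom)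
  have hinv : ∀ {r : ℝ}, 0 ≤ r → IntervalIntegrable (fun u => ((S.phi (-(r : ℂ)) u).re ^ 2)⁻¹) volume x x' :=
    fun {r} hr => (((hφc r).pow 2).inv₀ fun u hu =>
      (pow_pos (S.phi_neg_re_pos hr (hdom hu)) 2).ne').intervalIntegrable_of_Icc hx'.2
  show (∫ u in x..x', ((S.phi (-(s : ℂ)) u).re ^ 2)⁻¹) * ((S.phi (-(s : ℂ)) x).re / (S.phi (-(s' : ℂ)) x).re) ≤
    ∫ u in x..x', ((S.phi (-(s' : ℂ)) u).re ^ 2)⁻¹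
  rw [← intervalIntegral.integral_mul_const]
  refine intervalIntegral.integral_mono_on hx'.2 ((hinv hs.le).mul_const _) (hinv hs'.le) fun u hu => ?_
  have hud : u ∈ S.dom := hdom hu
  have hratio := S.phi_div_phi_mono hs'.le hss'.le hx hu.1 hud
  have hp : 0 < (S.phi (-(s : ℂ)) u).re := S.phi_neg_re_pos hs.le hud
  have hp' : 0 < (S.phi (-(s' : ℂ)) u).re := S.phi_neg_re_pos hs'.le hud
  have hle : (S.phi (-(s' : ℂ)) u).re ≤ (S.phi (-(s : ℂ)) u).re := S.phi_neg_re_mono_param hud hs'.le hss'.le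
  calc ((S.phi (-(s : ℂ)) u).re ^ 2)⁻¹ * ((S.phi (-(s : ℂ)) x).re / (S.phi (-(s' : ℂ)) x).re)
      ≤ ((S.phi (-(s : ℂ)) u).re ^ 2)⁻¹ * ((S.phi (-(s : ℂ)) u).re / (S.phi (-(s' : ℂ)) u).re) :=
        mul_le_mul_of_nonneg_left hratio (by positivity)
    _ = ((S.phi (-(s : ℂ)) u).re * (S.phi (-(s' : ℂ)) u).re)⁻¹ := by field_simp
    _ ≤ ((S.phi (-(s' : ℂ)) u).re ^ 2)⁻¹ := by
        rw [inv_le_inv₀ (by positivity) (by positivity)]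
        nlinarith

/-- For `0 < s' < s`: `ω(x,-s')/φ(x,-s) ≤ I(x,-s')`. [folklore] -/
theorem weylSolution_re_div_le' (hS : ¬ S.IsTrivial) {s s' : ℝ} (hs' : 0 < s') (hss' : s' < s) {x : ℝ}
    (hx : x ∈ S.dom) :
    (S.weylSolution (-(s' : ℂ)) x).re / (S.phi (-(s : ℂ)) x).re ≤ (S.tailInt (-(s' : ℂ)) x).re := by
  have hs : 0 < s := hs'.trans hss'
  rw [S.weylSolution_neg_re hS hs' hx]
  have hp : 0 < (S.phi (-(s : ℂ)) x).re := S.phi_neg_re_pos hs.le hx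
  have hle : (S.phi (-(s' : ℂ)) x).re ≤ (S.phi (-(s : ℂ)) x).re := S.phi_neg_re_mono_param hx hs'.le hss'.le
  have hI := S.tailInt_neg_re_nonneg hS hs' hx
  rw [div_le_iff₀ hp]
  nlinarith

/-- The Lagrange boundary term of `ω(·,-s)`, `ω(·,-s')`. [folklore] -/
def negBoundaryTerm (s s' x : ℝ) : ℂ :=
  S.weylSolution (-(s : ℂ)) x * S.weylDeriv (-(s' : ℂ)) x -
    S.weylDeriv (-(s : ℂ)) x * S.weylSolution (-(s' : ℂ)) x

/-- **`|B(x)| ≤ 2 I(x,-s')`** for `0 < s' < s`. [cite: KacKrein1974, §2] -/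
theorem norm_negBoundaryTerm_le (hS : ¬ S.IsTrivial) {s s' : ℝ} (hs' : 0 < s') (hss' : s' < s) {x : ℝ}
    (hx : x ∈ S.dom) : ‖S.negBoundaryTerm s s' x‖ ≤ 2 * (S.tailInt (-(s' : ℂ)) x).re := by
  have hs : 0 < s := hs'.trans hss'
  have h1 := S.weylSolution_re_div_le hS hs' hss' hx
  have h2 := S.weylSolution_re_div_le' hS hs' hss' hx
  have hp : 0 < (S.phi (-(s : ℂ)) x).re := S.phi_neg_re_pos hs.le hx
  have hp' : 0 < (S.phi (-(s' : ℂ)) x).re := S.phi_neg_re_pos hs'.le hx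
  unfold negBoundaryTerm
  calc ‖S.weylSolution (-(s : ℂ)) x * S.weylDeriv (-(s' : ℂ)) x -
        S.weylDeriv (-(s : ℂ)) x * S.weylSolution (-(s' : ℂ)) x‖
      ≤ ‖S.weylSolution (-(s : ℂ)) x‖ * ‖S.weylDeriv (-(s' : ℂ)) x‖ +
          ‖S.weylDeriv (-(s : ℂ)) x‖ * ‖S.weylSolution (-(s' : ℂ)) x‖ := by
        refine (norm_sub_le _ _).trans ?_
        rw [norm_mul, norm_mul]
    _ ≤ (S.weylSolution (-(s : ℂ)) x).re * ((S.phi (-(s' : ℂ)) x).re)⁻¹ +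
          ((S.phi (-(s : ℂ)) x).re)⁻¹ * (S.weylSolution (-(s' : ℂ)) x).re := by
        rw [S.norm_weylSolution_neg hS hs hx, S.norm_weylSolution_neg hS hs' hx]
        gcongr
        · exact S.weylSolution_neg_re_nonneg hS hs hx
        · exact S.norm_weylDeriv_neg_le hS hs' hx
        · exact S.weylSolution_neg_re_nonneg hS hs' hx
        · exact S.norm_weylDeriv_neg_le hS hs hx
    _ = (S.weylSolution (-(s : ℂ)) x).re / (S.phi (-(s' : ℂ)) x).re +
          (S.weylSolution (-(s' : ℂ)) x).re / (S.phi (-(s : ℂ)) x).re := by ring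
    _ ≤ 2 * (S.tailInt (-(s' : ℂ)) x).re := by linarith

/-- **The boundary term vanishes at `L`** (`0 < s' < s`). [cite: KacKrein1974, §2] -/
theorem tendsto_negBoundaryTerm (hS : ¬ S.IsTrivial) {s s' : ℝ} (hs' : 0 < s') (hss' : s' < s) :
    Tendsto (S.negBoundaryTerm s s') S.toEnd (𝓝 0) := by
  have hI : Tendsto (fun x => 2 * (S.tailInt (-(s' : ℂ)) x).re) S.toEnd (𝓝 0) := by
    have h := ((Complex.continuous_re.tendsto (0 : ℂ)).comp (S.tendsto_tailInt hS (neg_mem_offNonnegAxis hs'))).const_mul 2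
    simpa using h
  rw [tendsto_zero_iff_norm_tendsto_zero]
  refine squeeze_zero' (Filter.Eventually.of_forall fun x => norm_nonneg _) ?_ hI
  exact Filter.eventually_of_mem (S.Ici_inter_dom_mem_toEnd S.zero_mem_dom) fun x hx =>
    S.norm_negBoundaryTerm_le hS hs' hss' hx.1


/-! ### From truncated integrals to `∫ dm` -/

/-- A.e.-nonnegativity for `dm` from nonnegativity on `[0, L)`. [folklore] -/
lemma ae_nonneg_of_forall_mem_dom {f : ℝ → ℝ} (hf : ∀ u ∈ S.dom, 0 ≤ f u) : 0 ≤ᵐ[S.massMeasure] f := by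
  rw [Filter.EventuallyLE, ae_iff]
  refine measure_mono_null (fun u hu => ?_) S.massMeasure_compl_dom
  exact fun hd => hu (hf u hd)

/-- **Monotone exhaustion for Bochner integrals**: if `f ≥ 0` is continuous on `[0, L)` and
`∫_{[0,x]} f dm → A` as `x → L`, then `f ∈ L¹(dm)` and `∫ f dm = A`. [folklore] -/
theorem integrable_and_integral_eq_of_tendsto {f : ℝ → ℝ} (hf0 : ∀ u ∈ S.dom, 0 ≤ f u)
    (hfc : ContinuousOn f S.dom) {A : ℝ}
    (hlim : Tendsto (fun x => ∫ u in Icc 0 x, f u ∂S.massMeasure) S.toEnd (𝓝 A)) :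
    Integrable f S.massMeasure ∧ ∫ u, f u ∂S.massMeasure = A := by
  have hmeas : AEStronglyMeasurable f S.massMeasure := S.aestronglyMeasurable_of_continuousOn hfc
  have hae := S.ae_nonneg_of_forall_mem_dom hf0
  set a : ℕ → ℝ := fun n => ∫ u in Icc 0 (S.exhaust n), f u ∂S.massMeasure
  have hint : ∀ n, IntegrableOn f (Icc 0 (S.exhaust n)) S.massMeasure := fun n =>
    S.integrableOn_Icc_of_continuousOn (S.exhaust_mem_dom n) (hfc.mono (S.Icc_subset_dom (S.exhaust_mem_dom n)))
  have ha : ∀ n, ∫⁻ u in Icc 0 (S.exhaust n), ENNReal.ofReal (f u) ∂S.massMeasure = ENNReal.ofReal (a n) :=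
    fun n => (ofReal_integral_eq_lintegral_ofReal (hint n) ((ae_restrict_iff' measurableSet_Icc).2
      (ae_of_all _ fun u hu => hf0 u (S.Icc_subset_dom (S.exhaust_mem_dom n) hu)))).symm
  have hlim' : Tendsto a atTop (𝓝 A) := hlim.comp S.tendsto_exhaust
  have hmono : Monotone fun n => ENNReal.ofReal (a n) := by
    intro m n hmn
    show ENNReal.ofReal (a m) ≤ ENNReal.ofReal (a n)
    rw [← ha, ← ha]
    exact lintegral_mono_set (Icc_subset_Icc_right (S.monotone_exhaust hmn))
  have hsup : Tendsto (fun n => ENNReal.ofReal (a n)) atTop (𝓝 (⨆ n, ENNReal.ofReal (a n))) :=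
    tendsto_atTop_iSup hmono
  have hlim'' : Tendsto (fun n => ENNReal.ofReal (a n)) atTop (𝓝 (ENNReal.ofReal A)) :=
    (ENNReal.continuous_ofReal.tendsto _).comp hlim'
  have hA : 0 ≤ A := by
    refine ge_of_tendsto' hlim' fun n => ?_
    exact setIntegral_nonneg measurableSet_Icc fun u hu => hf0 u (S.Icc_subset_dom (S.exhaust_mem_dom n) hu)
  have hlint : ∫⁻ u, ENNReal.ofReal (f u) ∂S.massMeasure = ENNReal.ofReal A := by
    rw [S.lintegral_eq_iSup]
    simp only [ha]
    exact tendsto_nhds_unique hsup hlim''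
  have hfin : HasFiniteIntegral f S.massMeasure := by
    rw [hasFiniteIntegral_iff_ofReal hae, hlint]
    exact ENNReal.ofReal_lt_top
  refine ⟨⟨hmeas, hfin⟩, ?_⟩
  rw [integral_eq_lintegral_of_nonneg_ae hae hmeas, hlint, ENNReal.toReal_ofReal hA]

/-! ### The Gram identity for `s ≠ s'` -/

/-- **Lagrange identity for two Weyl solutions** on the negative axis:
`(s - s') ∫_{[0,x]} ω(·,-s) ω(·,-s') dm = q_S(-s') - q_S(-s) - B(x)`. [cite: KacKrein1974, §2] -/
theorem lagrange_weylSolution_neg (s s' : ℝ) {x : ℝ} (hx : x ∈ S.dom) :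
    ((s : ℂ) - s') * ∫ v in Icc 0 x, S.weylSolution (-(s : ℂ)) v * S.weylSolution (-(s' : ℂ)) v ∂S.massMeasure =
      S.principalWeylFunction (-(s' : ℂ)) - S.principalWeylFunction (-(s : ℂ)) - S.negBoundaryTerm s s' x := by
  have hL := (S.isSolution_weylSolution (-(s : ℂ))).lagrange (S.isSolution_weylSolution (-(s' : ℂ))) hx
  have e1 : (-1 : ℂ) - -(s' : ℂ) * ∫ v in Icc 0 x, S.weylSolution (-(s' : ℂ)) v ∂S.massMeasure =
      S.weylDeriv (-(s' : ℂ)) x := rfl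
  have e2 : (-1 : ℂ) - -(s : ℂ) * ∫ v in Icc 0 x, S.weylSolution (-(s : ℂ)) v ∂S.massMeasure =
      S.weylDeriv (-(s : ℂ)) x := rfl
  rw [e1, e2] at hL
  unfold negBoundaryTerm
  linear_combination hL

/-- The product `ω(·,-s) ω(·,-s')` on the negative axis: real, non-negative. [folklore] -/
lemma weylSolution_mul_eq_re (hS : ¬ S.IsTrivial) {s s' : ℝ} (hs : 0 < s) (hs' : 0 < s') {v : ℝ} (hv : v ∈ S.dom) :
    S.weylSolution (-(s : ℂ)) v * S.weylSolution (-(s' : ℂ)) v =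
      (((S.weylSolution (-(s : ℂ)) v).re * (S.weylSolution (-(s' : ℂ)) v).re : ℝ) : ℂ) := by
  conv_lhs => rw [show S.weylSolution (-(s : ℂ)) v = ((S.weylSolution (-(s : ℂ)) v).re : ℂ) from by
      rw [S.weylSolution_neg_eq_re hS hs hv, Complex.ofReal_re],
    show S.weylSolution (-(s' : ℂ)) v = ((S.weylSolution (-(s' : ℂ)) v).re : ℂ) from by
      rw [S.weylSolution_neg_eq_re hS hs' hv, Complex.ofReal_re]]
  push_cast
  ring

/-- **Gram identity, string side** (`0 < s' < s`): `ω(·,-s) ω(·,-s') ∈ L¹(dm)` and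
`(s - s') ∫ ω(·,-s) ω(·,-s') dm = Re q_S(-s') - Re q_S(-s)`. [cite: KacKrein1974, §2] -/
theorem integral_weylSolution_mul_neg (hS : ¬ S.IsTrivial) {s s' : ℝ} (hs' : 0 < s') (hss' : s' < s) :
    Integrable (fun v => (S.weylSolution (-(s : ℂ)) v).re * (S.weylSolution (-(s' : ℂ)) v).re) S.massMeasure ∧
      (s - s') * ∫ v, (S.weylSolution (-(s : ℂ)) v).re * (S.weylSolution (-(s' : ℂ)) v).re ∂S.massMeasure =
        (S.principalWeylFunction (-(s' : ℂ))).re - (S.principalWeylFunction (-(s : ℂ))).re := by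
  have hs : 0 < s := hs'.trans hss'
  set f : ℝ → ℝ := fun v => (S.weylSolution (-(s : ℂ)) v).re * (S.weylSolution (-(s' : ℂ)) v).re with hf
  have hf0 : ∀ v ∈ S.dom, 0 ≤ f v := fun v hv =>
    mul_nonneg (S.weylSolution_neg_re_nonneg hS hs hv) (S.weylSolution_neg_re_nonneg hS hs' hv)
  have hfc : ContinuousOn f S.dom :=
    (Complex.continuous_re.comp_continuousOn (S.continuousOn_weylSolution _)).mul
      (Complex.continuous_re.comp_continuousOn (S.continuousOn_weylSolution _))
  -- truncated integrals in terms of `q` and `B`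
  have htrunc : ∀ x ∈ S.dom, ∫ v in Icc 0 x, f v ∂S.massMeasure =
      ((S.principalWeylFunction (-(s' : ℂ))).re - (S.principalWeylFunction (-(s : ℂ))).re -
        (S.negBoundaryTerm s s' x).re) / (s - s') := by
    intro x hx
    have hL := S.lagrange_weylSolution_neg s s' hx
    have hI : ∫ v in Icc 0 x, S.weylSolution (-(s : ℂ)) v * S.weylSolution (-(s' : ℂ)) v ∂S.massMeasure =
        ((∫ v in Icc 0 x, f v ∂S.massMeasure : ℝ) : ℂ) := by
      rw [← integral_complex_ofReal]
      exact setIntegral_congr_fun measurableSet_Icc fun v hv =>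
        S.weylSolution_mul_eq_re hS hs hs' (S.Icc_subset_dom hx hv)
    rw [hI] at hL
    have hre := congrArg Complex.re hL
    simp only [Complex.mul_re, Complex.sub_re, Complex.ofReal_re, Complex.ofReal_im, mul_zero,
      sub_zero, Complex.sub_im] at hre
    have hne : s - s' ≠ 0 := by linarith
    field_simp
    linarith
  have hlim : Tendsto (fun x => ∫ v in Icc 0 x, f v ∂S.massMeasure) S.toEnd
      (𝓝 (((S.principalWeylFunction (-(s' : ℂ))).re - (S.principalWeylFunction (-(s : ℂ))).re - 0) / (s - s'))) := by
    have hB := (Complex.continuous_re.tendsto (0 : ℂ)).comp (S.tendsto_negBoundaryTerm hS hs' hss')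
    simp only [Function.comp_def, Complex.zero_re] at hB
    have h2 := ((tendsto_const_nhds (x := (S.principalWeylFunction (-(s' : ℂ))).re -
      (S.principalWeylFunction (-(s : ℂ))).re)).sub hB).div_const (s - s')
    refine h2.congr' ?_
    exact Filter.eventually_of_mem (S.Ici_inter_dom_mem_toEnd S.zero_mem_dom) fun x hx => (htrunc x hx.1).symm
  obtain ⟨hint, heq⟩ := S.integrable_and_integral_eq_of_tendsto hf0 hfc hlim
  refine ⟨hint, ?_⟩
  rw [heq]
  have hne : s - s' ≠ 0 := by linarith
  field_simp
  ring

/-! ### The spectral side -/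

section Spectral

variable {q : ℂ → ℂ} {b : ℝ} {σ : Measure ℝ}

/-- Integrability of `((t+s)(t+s'))⁻¹` against Stieltjes data (`s, s' > 0`). [folklore] -/
lemma integrable_inv_mul_shift (h : HasStieltjesRepresentation q b σ) {s s' : ℝ} (hs : 0 < s) (hs' : 0 < s') :
    Integrable (fun t : ℝ => ((t + s) * (t + s'))⁻¹) σ := by
  have hw := integrable_inv_one_add_of_hasStieltjesRepresentation h
  set C : ℝ := (max 1 s⁻¹) * s'⁻¹ with hC
  refine Integrable.mono' (hw.const_mul C) (by fun_prop) ?_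
  filter_upwards [ae_nonneg_of_hasStieltjesRepresentation h] with t ht
  rw [Real.norm_eq_abs, abs_of_nonneg (by positivity)]
  -- `((t+s)(t+s'))⁻¹ ≤ (t+s)⁻¹ s'⁻¹ ≤ max 1 s⁻¹ (1+t)⁻¹ s'⁻¹`
  have h1 : ((t + s) * (t + s'))⁻¹ ≤ (t + s)⁻¹ * s'⁻¹ := by
    rw [mul_inv]
    exact mul_le_mul_of_nonneg_left (inv_anti₀ hs' (by linarith))
      (inv_nonneg.2 (by positivity : (0 : ℝ) ≤ t + s))
  have h2 : (t + s)⁻¹ ≤ max 1 s⁻¹ * (1 + t)⁻¹ := by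
    rw [inv_le_comm₀ (by positivity) (by positivity), mul_inv, inv_inv]
    rcases le_or_gt 1 s with hs1 | hs1
    · have : (max 1 s⁻¹) = 1 := max_eq_left (inv_le_one_of_one_le₀ hs1)
      rw [this]; simp; linarith
    · have : (max 1 s⁻¹) = s⁻¹ := max_eq_right (one_le_inv₀ hs |>.2 hs1.le)
      rw [this, inv_inv]
      nlinarith
  calc ((t + s) * (t + s'))⁻¹ ≤ (t + s)⁻¹ * s'⁻¹ := h1
    _ ≤ max 1 s⁻¹ * (1 + t)⁻¹ * s'⁻¹ := by gcongr
    _ = C * (1 + t)⁻¹ := by rw [hC]; ring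

/-- `q(-s') - q(-s) = (s - s') ∫ dσ(t)/((t+s)(t+s'))` for Stieltjes data. [folklore] -/
theorem stieltjes_apply_neg_sub (h : HasStieltjesRepresentation q b σ) {s s' : ℝ} (hs : 0 < s) (hs' : 0 < s') :
    q (-(s' : ℂ)) - q (-(s : ℂ)) = (((s - s') * ∫ t, ((t + s) * (t + s'))⁻¹ ∂σ : ℝ) : ℂ) := by
  have hzs : (-(s : ℂ)) ∈ offNonnegAxis := neg_mem_offNonnegAxis hs
  have hzs' : (-(s' : ℂ)) ∈ offNonnegAxis := neg_mem_offNonnegAxis hs'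
  rw [h.2.2.2 _ hzs, h.2.2.2 _ hzs', add_sub_add_left_eq_sub,
    ← integral_sub (integrable_inv_sub_stieltjes h hzs') (integrable_inv_sub_stieltjes h hzs),
    Complex.ofReal_mul, ← integral_complex_ofReal, ← integral_const_mul]
  refine integral_congr_ae ?_
  filter_upwards [ae_nonneg_of_hasStieltjesRepresentation h] with t ht
  have h1 : (t : ℂ) + s ≠ 0 := by
    intro h0; have := congrArg Complex.re h0; simp at this; linarith
  have h2 : (t : ℂ) + s' ≠ 0 := by
    intro h0; have := congrArg Complex.re h0; simp at this; linarith
  rw [sub_neg_eq_add, sub_neg_eq_add]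
  push_cast
  field_simp
  ring

end Spectral

/-- **Gram identity** (`0 < s' < s`):
`∫ ω(·,-s) ω(·,-s') dm = ∫ dσ_S(t)/((t+s)(t+s'))`. [cite: KacKrein1974, §2; DymMcKean1976, §5.4] -/
theorem integral_weylSolution_mul_neg_eq (hS : ¬ S.IsTrivial) {s s' : ℝ} (hs' : 0 < s') (hss' : s' < s) :
    ∫ v, (S.weylSolution (-(s : ℂ)) v).re * (S.weylSolution (-(s' : ℂ)) v).re ∂S.massMeasure =
      ∫ t, ((t + s) * (t + s'))⁻¹ ∂S.spectralMeasure := by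
  have hs : 0 < s := hs'.trans hss'
  have h := S.hasStieltjesRepresentation hS
  have h1 := (S.integral_weylSolution_mul_neg hS hs' hss').2
  have h2 := stieltjes_apply_neg_sub h hs hs'
  have h3 := congrArg Complex.re h2
  simp only [Complex.sub_re, Complex.ofReal_re] at h3
  have hne : s - s' ≠ 0 := by linarith
  have : (s - s') * ∫ v, (S.weylSolution (-(s : ℂ)) v).re * (S.weylSolution (-(s' : ℂ)) v).re ∂S.massMeasure =
      (s - s') * ∫ t, ((t + s) * (t + s'))⁻¹ ∂S.spectralMeasure := by linarith
  exact mul_left_cancel₀ hne this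


/-! ### The diagonal: Fatou and Cauchy–Schwarz -/

/-- `∫ dσ_S(t)/((t+s)(t+s'))`, the Gram kernel on the spectral side. [folklore] -/
def gramKernel (s s' : ℝ) : ℝ := ∫ t, ((t + s) * (t + s'))⁻¹ ∂S.spectralMeasure

/-- Continuity of the Gram kernel: `K(s, s + εₙ) → K(s, s)`, `εₙ = 1/(n+1)`. [folklore] -/
lemma tendsto_gramKernel (hS : ¬ S.IsTrivial) {s : ℝ} (hs : 0 < s) :
    Tendsto (fun n : ℕ => S.gramKernel s (s + 1 / ((n : ℝ) + 1))) atTop (𝓝 (S.gramKernel s s)) := by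
  have h := S.hasStieltjesRepresentation hS
  unfold gramKernel
  refine tendsto_integral_of_dominated_convergence (fun t => ((t + s) * (t + s))⁻¹) (fun n => by fun_prop)
    (integrable_inv_mul_shift h hs hs) ?_ ?_
  · intro n
    filter_upwards [ae_nonneg_of_hasStieltjesRepresentation h] with t ht
    rw [Real.norm_eq_abs, abs_of_nonneg (by positivity)]
    refine inv_anti₀ (by positivity) ?_
    have : 0 ≤ 1 / ((n : ℝ) + 1) := by positivity
    nlinarith
  · filter_upwards [ae_nonneg_of_hasStieltjesRepresentation h] with t ht
    have hlim : Tendsto (fun n : ℕ => s + 1 / ((n : ℝ) + 1)) atTop (𝓝 s) := by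
      simpa using (tendsto_one_div_add_atTop_nhds_zero_nat (𝕜 := ℝ)).const_add s
    have hc : ContinuousAt (fun s' : ℝ => ((t + s) * (t + s'))⁻¹) s :=
      ((continuousAt_const.mul (continuousAt_const.add continuousAt_id)).inv₀
        (by show (t + s) * (t + s) ≠ 0; positivity))
    exact hc.tendsto.comp hlim

/-- The same for `K(s + εₙ, s + εₙ) → K(s, s)`. [folklore] -/
lemma tendsto_gramKernel_diag (hS : ¬ S.IsTrivial) {s : ℝ} (hs : 0 < s) :
    Tendsto (fun n : ℕ => S.gramKernel (s + 1 / ((n : ℝ) + 1)) (s + 1 / ((n : ℝ) + 1))) atTop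
      (𝓝 (S.gramKernel s s)) := by
  have h := S.hasStieltjesRepresentation hS
  unfold gramKernel
  refine tendsto_integral_of_dominated_convergence (fun t => ((t + s) * (t + s))⁻¹) (fun n => by fun_prop)
    (integrable_inv_mul_shift h hs hs) ?_ ?_
  · intro n
    filter_upwards [ae_nonneg_of_hasStieltjesRepresentation h] with t ht
    rw [Real.norm_eq_abs, abs_of_nonneg (by positivity)]
    refine inv_anti₀ (by positivity) ?_
    have : 0 ≤ 1 / ((n : ℝ) + 1) := by positivity
    nlinarith
  · filter_upwards [ae_nonneg_of_hasStieltjesRepresentation h] with t ht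
    have hlim : Tendsto (fun n : ℕ => s + 1 / ((n : ℝ) + 1)) atTop (𝓝 s) := by
      simpa using (tendsto_one_div_add_atTop_nhds_zero_nat (𝕜 := ℝ)).const_add s
    have hc : ContinuousAt (fun s' : ℝ => ((t + s') * (t + s'))⁻¹) s :=
      (((continuousAt_const.add continuousAt_id).mul (continuousAt_const.add continuousAt_id)).inv₀
        (by show (t + s) * (t + s) ≠ 0; positivity))
    exact hc.tendsto.comp hlim

/-- `Im q_S(-s + iy) / y = ∫ dσ_S(t)/((t+s)² + y²)` (`y > 0`). [cite: KacKrein1974, Supplement I §S1.2] -/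
lemma im_div_eq_integral (hS : ¬ S.IsTrivial) (s : ℝ) {y : ℝ} (hy : 0 < y) :
    (S.principalWeylFunction (-(s : ℂ) + y * Complex.I)).im / y =
      ∫ t, ((t + s) ^ 2 + y ^ 2)⁻¹ ∂S.spectralMeasure := by
  have h := im_apply_eq_poisson_integral (S.hasStieltjesRepresentation hS) (-s) hy
  rw [Complex.ofReal_neg] at h
  rw [h, ← integral_div]
  refine integral_congr_ae (ae_of_all _ fun t => ?_)
  simp only [sub_neg_eq_add]
  field_simp

/-- Continuity of `z ↦ ω(u, z)` at `-s` (`u ∈ [0, L)`). [folklore] -/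
lemma continuousAt_weylSolution_param (hS : ¬ S.IsTrivial) {s : ℝ} (hs : 0 < s) {u : ℝ} (hu : u ∈ S.dom) :
    ContinuousAt (fun z => S.weylSolution z u) (-(s : ℂ)) := by
  unfold weylSolution
  have hq : ContinuousAt S.principalWeylFunction (-(s : ℂ)) :=
    ((S.differentiableOn_principalWeylFunction hS).continuousOn).continuousAt
      (isOpen_offNonnegAxis.mem_nhds (neg_mem_offNonnegAxis hs))
  exact (hq.mul (S.differentiable_phi hu).continuous.continuousAt).sub
    (S.differentiable_psi hu).continuous.continuousAt

/-- **Fatou on the negative axis**: `ω(·,-s) ∈ L²(dm)` and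
`∫ ω(t,-s)² dm(t) ≤ ∫ dσ_S(t)/(t+s)²`. [cite: KacKrein1974, §2] -/
theorem memLp_weylSolution_neg (hS : ¬ S.IsTrivial) {s : ℝ} (hs : 0 < s) :
    MemLp (S.weylSolution (-(s : ℂ))) 2 S.massMeasure ∧
      ∫ v, (S.weylSolution (-(s : ℂ)) v).re ^ 2 ∂S.massMeasure ≤ S.gramKernel s s := by
  -- the approximating non-real points
  set y : ℕ → ℝ := fun n => 1 / ((n : ℝ) + 1) with hy
  have hy0 : ∀ n, 0 < y n := fun n => by positivity
  set z : ℕ → ℂ := fun n => -(s : ℂ) + y n * Complex.I with hz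
  have hzim : ∀ n, (z n).im = y n := fun n => by simp [hz]
  have hzim0 : ∀ n, (z n).im ≠ 0 := fun n => by rw [hzim]; exact (hy0 n).ne'
  have hzlim : Tendsto z atTop (𝓝 (-(s : ℂ))) := by
    have h1 : Tendsto y atTop (𝓝 0) := tendsto_one_div_add_atTop_nhds_zero_nat (𝕜 := ℝ)
    have h2 := ((Complex.continuous_ofReal.tendsto 0).comp h1).mul_const Complex.I
    simpa [hz] using h2.const_add (-(s : ℂ))
  -- the `L²` norms of the approximants
  set F : ℕ → ℝ → ℝ≥0∞ := fun n v => ENNReal.ofReal (‖S.weylSolution (z n) v‖ ^ 2) with hF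
  have hFint : ∀ n, ∫⁻ v, F n v ∂S.massMeasure ≤ ENNReal.ofReal (S.gramKernel s s) := by
    intro n
    rw [S.lintegral_norm_weylSolution_sq hS (hzim0 n), hzim, S.im_div_eq_integral hS s (hy0 n)]
    refine ENNReal.ofReal_le_ofReal (integral_mono_ae ?_ (integrable_inv_mul_shift
      (S.hasStieltjesRepresentation hS) hs hs) ?_)
    · refine (integrable_inv_mul_shift (S.hasStieltjesRepresentation hS) hs hs).mono' (by fun_prop) ?_
      filter_upwards [ae_nonneg_of_hasStieltjesRepresentation (S.hasStieltjesRepresentation hS)] with t ht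
      rw [Real.norm_eq_abs, abs_of_nonneg (by positivity)]
      refine inv_anti₀ (by positivity) ?_
      nlinarith [sq_nonneg (y n)]
    · filter_upwards [ae_nonneg_of_hasStieltjesRepresentation (S.hasStieltjesRepresentation hS)] with t ht
      refine inv_anti₀ (by positivity) ?_
      nlinarith [sq_nonneg (y n)]
  -- Fatou
  have hmeas : ∀ n, AEMeasurable (F n) S.massMeasure := fun n =>
    ((S.aestronglyMeasurable_of_continuousOn (S.continuousOn_weylSolution (z n))).norm.aemeasurable.pow_const 2).ennreal_ofReal
  have hFatou := lintegral_liminf_le' (μ := S.massMeasure) (u := atTop) hmeas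
  have hlimF : ∀ v ∈ S.dom, liminf (fun n => F n v) atTop = ENNReal.ofReal (‖S.weylSolution (-(s : ℂ)) v‖ ^ 2) := by
    intro v hv
    refine Tendsto.liminf_eq ?_
    have h1 := ((S.continuousAt_weylSolution_param hS hs hv).tendsto.comp hzlim).norm
    exact (ENNReal.continuous_ofReal.tendsto _).comp (h1.pow 2)
  have hae : (fun v => liminf (fun n => F n v) atTop) =ᵐ[S.massMeasure]
      fun v => ENNReal.ofReal (‖S.weylSolution (-(s : ℂ)) v‖ ^ 2) := by
    rw [Filter.EventuallyEq, ae_iff]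
    refine measure_mono_null (fun v hv => fun hd => hv (hlimF v hd)) S.massMeasure_compl_dom
  have hbound : ∫⁻ v, ENNReal.ofReal (‖S.weylSolution (-(s : ℂ)) v‖ ^ 2) ∂S.massMeasure ≤
      ENNReal.ofReal (S.gramKernel s s) := by
    rw [← lintegral_congr_ae hae]
    refine hFatou.trans ?_
    refine liminf_le_of_le (by isBoundedDefault) fun b hb => ?_
    obtain ⟨n, hn⟩ := hb.exists
    exact hn.trans (hFint n)
  -- conclusions
  have hmeas' : AEStronglyMeasurable (S.weylSolution (-(s : ℂ))) S.massMeasure :=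
    S.aestronglyMeasurable_of_continuousOn (S.continuousOn_weylSolution _)
  have hK0 : 0 ≤ S.gramKernel s s := by
    unfold gramKernel
    refine integral_nonneg_of_ae ?_
    filter_upwards [ae_nonneg_of_hasStieltjesRepresentation (S.hasStieltjesRepresentation hS)] with t ht
    positivity
  have hlint_eq : ∫⁻ v, ‖‖S.weylSolution (-(s : ℂ)) v‖ ^ 2‖ₑ ∂S.massMeasure =
      ∫⁻ v, ENNReal.ofReal (‖S.weylSolution (-(s : ℂ)) v‖ ^ 2) ∂S.massMeasure :=
    lintegral_congr fun v => Real.enorm_eq_ofReal (by positivity)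
  constructor
  · rw [memLp_two_iff_integrable_sq_norm hmeas']
    refine ⟨hmeas'.norm.pow 2, ?_⟩
    rw [hasFiniteIntegral_iff_enorm, hlint_eq]
    exact hbound.trans_lt ENNReal.ofReal_lt_top
  · have hre : ∀ v, (S.weylSolution (-(s : ℂ)) v).re ^ 2 ≤ ‖S.weylSolution (-(s : ℂ)) v‖ ^ 2 := fun v => by
      rw [Complex.sq_norm, Complex.normSq_apply]
      nlinarith [sq_nonneg (S.weylSolution (-(s : ℂ)) v).im]
    calc ∫ v, (S.weylSolution (-(s : ℂ)) v).re ^ 2 ∂S.massMeasure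
        ≤ ∫ v, ‖S.weylSolution (-(s : ℂ)) v‖ ^ 2 ∂S.massMeasure := by
          refine integral_mono_of_nonneg (ae_of_all _ fun v => sq_nonneg _) ?_ (ae_of_all _ hre)
          exact ⟨hmeas'.norm.pow 2, by rw [hasFiniteIntegral_iff_enorm, hlint_eq]; exact hbound.trans_lt ENNReal.ofReal_lt_top⟩
      _ ≤ S.gramKernel s s := by
          have hm2 : AEStronglyMeasurable (fun v => ‖S.weylSolution (-(s : ℂ)) v‖ ^ 2) S.massMeasure :=
            hmeas'.norm.pow 2
          rw [integral_eq_lintegral_of_nonneg_ae (ae_of_all _ fun v => by positivity) hm2]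
          exact ENNReal.toReal_le_of_le_ofReal hK0 hbound


/-- Symmetry of the Gram kernel. [folklore] -/
lemma gramKernel_comm (s s' : ℝ) : S.gramKernel s s' = S.gramKernel s' s := by
  unfold gramKernel
  exact integral_congr_ae (ae_of_all _ fun t => by simp only [mul_comm])

/-- Auxiliary fact about Kreĭn strings (see the section header). [folklore] -/
lemma gramKernel_nonneg (hS : ¬ S.IsTrivial) {s s' : ℝ} (hs : 0 < s) (hs' : 0 < s') : 0 ≤ S.gramKernel s s' := by
  unfold gramKernel
  refine integral_nonneg_of_ae ?_
  filter_upwards [ae_nonneg_of_hasStieltjesRepresentation (S.hasStieltjesRepresentation hS)] with t ht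
  positivity

/-- `Re ω(·,-s) ∈ L²(dm)`. [folklore] -/
lemma memLp_weylSolution_neg_re (hS : ¬ S.IsTrivial) {s : ℝ} (hs : 0 < s) :
    MemLp (fun v => (S.weylSolution (-(s : ℂ)) v).re) 2 S.massMeasure := by
  refine (S.memLp_weylSolution_neg hS hs).1.of_le ?_ (ae_of_all _ fun v => ?_)
  · exact Complex.continuous_re.comp_aestronglyMeasurable
      (S.aestronglyMeasurable_of_continuousOn (S.continuousOn_weylSolution _))
  · rw [Real.norm_eq_abs]
    exact Complex.abs_re_le_norm _

/-- **The diagonal Gram identity**: `∫ ω(t,-s)² dm(t) = ∫ dσ_S(t)/(t+s)²`. [cite: KacKrein1974, §2] -/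
theorem integral_weylSolution_neg_sq (hS : ¬ S.IsTrivial) {s : ℝ} (hs : 0 < s) :
    ∫ v, (S.weylSolution (-(s : ℂ)) v).re ^ 2 ∂S.massMeasure = S.gramKernel s s := by
  set X : ℝ := ∫ v, (S.weylSolution (-(s : ℂ)) v).re ^ 2 ∂S.massMeasure with hX
  have hle : X ≤ S.gramKernel s s := (S.memLp_weylSolution_neg hS hs).2
  have hX0 : 0 ≤ X := integral_nonneg fun v => sq_nonneg _
  refine le_antisymm hle ?_
  -- the off-diagonal identities with `s'ₙ = s + 1/(n+1)`
  set s' : ℕ → ℝ := fun n => s + 1 / ((n : ℝ) + 1) with hs'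
  have hss' : ∀ n, s < s' n := fun n => by
    have : (0:ℝ) < 1 / ((n : ℝ) + 1) := by positivity
    show s < s + 1 / ((n : ℝ) + 1)
    linarith
  have hs'0 : ∀ n, 0 < s' n := fun n => hs.trans (hss' n)
  have hG : ∀ n, ∫ v, (S.weylSolution (-(s' n : ℂ)) v).re * (S.weylSolution (-(s : ℂ)) v).re ∂S.massMeasure =
      S.gramKernel s (s' n) := fun n => by
    rw [S.integral_weylSolution_mul_neg_eq hS hs (hss' n), S.gramKernel_comm]; rfl
  -- Cauchy–Schwarz
  have hCS : ∀ n, S.gramKernel s (s' n) ≤ Real.sqrt (S.gramKernel (s' n) (s' n)) * Real.sqrt X := by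
    intro n
    rw [← hG n]
    have hf := S.memLp_weylSolution_neg_re hS (hs'0 n)
    have hg := S.memLp_weylSolution_neg_re hS hs
    have h := integral_mul_le_Lp_mul_Lq_of_nonneg (μ := S.massMeasure) Real.HolderConjugate.two_two
      (S.ae_nonneg_of_forall_mem_dom fun v hv => S.weylSolution_neg_re_nonneg hS (hs'0 n) hv)
      (S.ae_nonneg_of_forall_mem_dom fun v hv => S.weylSolution_neg_re_nonneg hS hs hv)
      (by simpa using hf) (by simpa using hg)
    refine h.trans ?_
    have e1 : (∫ v, (S.weylSolution (-(s' n : ℂ)) v).re ^ (2 : ℝ) ∂S.massMeasure) ^ (1 / (2 : ℝ)) =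
        Real.sqrt (∫ v, (S.weylSolution (-(s' n : ℂ)) v).re ^ 2 ∂S.massMeasure) := by
      rw [Real.sqrt_eq_rpow]; congr 1; exact integral_congr_ae (ae_of_all _ fun v => by simp)
    have e2 : (∫ v, (S.weylSolution (-(s : ℂ)) v).re ^ (2 : ℝ) ∂S.massMeasure) ^ (1 / (2 : ℝ)) = Real.sqrt X := by
      rw [Real.sqrt_eq_rpow, hX]; congr 1; exact integral_congr_ae (ae_of_all _ fun v => by simp)
    rw [e1, e2]
    gcongr
    exact (S.memLp_weylSolution_neg hS (hs'0 n)).2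
  -- pass to the limit
  have h1 : Tendsto (fun n => S.gramKernel s (s' n)) atTop (𝓝 (S.gramKernel s s)) := S.tendsto_gramKernel hS hs
  have h2 : Tendsto (fun n => Real.sqrt (S.gramKernel (s' n) (s' n)) * Real.sqrt X) atTop
      (𝓝 (Real.sqrt (S.gramKernel s s) * Real.sqrt X)) :=
    ((Real.continuous_sqrt.tendsto _).comp (S.tendsto_gramKernel_diag hS hs)).mul_const _
  have hlim : S.gramKernel s s ≤ Real.sqrt (S.gramKernel s s) * Real.sqrt X :=
    le_of_tendsto_of_tendsto' h1 h2 hCS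
  have hK0 := S.gramKernel_nonneg hS hs hs
  rcases eq_or_lt_of_le hK0 with hK | hK
  · rw [← hK]; exact hX0
  · have hsq : Real.sqrt (S.gramKernel s s) ≤ Real.sqrt X := by
      have hpos : 0 < Real.sqrt (S.gramKernel s s) := Real.sqrt_pos.2 hK
      have : Real.sqrt (S.gramKernel s s) * Real.sqrt (S.gramKernel s s) ≤ Real.sqrt (S.gramKernel s s) * Real.sqrt X := by
        rw [Real.mul_self_sqrt hK0]; exact hlim
      exact le_of_mul_le_mul_left this hpos
    exact (Real.sqrt_le_sqrt_iff hX0).1 hsq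

/-- **The Gram identity on the negative axis** (`s, s' > 0`):
`ω(·,-s) ω(·,-s') ∈ L¹(dm)` and `∫ ω(t,-s) ω(t,-s') dm(t) = ∫ dσ_S(t)/((t+s)(t+s'))`.
[cite: KacKrein1974, §2; DymMcKean1976, §5.4] -/
theorem gram_weylSolution_neg (hS : ¬ S.IsTrivial) {s s' : ℝ} (hs : 0 < s) (hs' : 0 < s') :
    Integrable (fun v => (S.weylSolution (-(s : ℂ)) v).re * (S.weylSolution (-(s' : ℂ)) v).re) S.massMeasure ∧
      ∫ v, (S.weylSolution (-(s : ℂ)) v).re * (S.weylSolution (-(s' : ℂ)) v).re ∂S.massMeasure = S.gramKernel s s' := by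
  rcases lt_trichotomy s' s with hlt | heq | hgt
  · exact ⟨(S.integral_weylSolution_mul_neg hS hs' hlt).1, S.integral_weylSolution_mul_neg_eq hS hs' hlt⟩
  · subst heq
    refine ⟨?_, ?_⟩
    · have h := (S.memLp_weylSolution_neg_re hS hs).integrable_mul (S.memLp_weylSolution_neg_re hS hs)
      exact h
    · rw [← S.integral_weylSolution_neg_sq hS hs]
      exact integral_congr_ae (ae_of_all _ fun v => by ring)
  · have h1 := (S.integral_weylSolution_mul_neg hS hs hgt).1
    have h2 := S.integral_weylSolution_mul_neg_eq hS hs hgt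
    refine ⟨?_, ?_⟩
    · exact h1.congr (ae_of_all _ fun v => by simp only; ring)
    · rw [S.gramKernel_comm]
      unfold gramKernel
      rw [← h2]
      exact integral_congr_ae (ae_of_all _ fun v => by simp only; ring)

end KreinString

end Literature.Analysis.InverseSpectral

end
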